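import Summits.QuantumFields.YangMills.Theorems.BalabanUVNodesN08ReMassedACLeaves
import Summits.QuantumFields.YangMills.Theorems.BalabanUVNodesN08MassesACLeastClosedFamilyPrint

/-!
# BalabanUVNodes ∕ N08 — THE RE-MASSED AC TOWER, III-b: THE SLOT OF RECORD `Node00.PrintedUV3V N L` FROM THE (α)-AC ROWS AND A `dU`-ALMOST-EVERYWHERE EXTENSIVE BOUND ON
# PRINT'S ITERATED RADON–NIKODYM HISTORY MASSES — file 15's VERSION CAVEAT DISSOLVED (part (b) of `N08-E6PRIME-LOAD-POINT.md`, built Summits-side)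

Track A, DAG node N08 = T. Bałaban, CMP **102** (1985) 255–275 [Balaban1985UV3]: Thm 1 p. 257 (bounds (5)), Thm 2 p. 272, (41) p. 266, (7) p. 257, pp. 273–274; print's averaging (2) =
[Balaban1985Averaging] (15) p. 19; the typed (0.4) averaging's guard = [Balaban1987RG1] (0.4) p. 253.  Cell `pub-ymgap`, width seat `pub-ymgap-dag-n08-w1` (g4), W-SEAT-START-LIST
§n08 item 1 successor piece (o16) = file 21b; `--supports` K1⁷ `StabilityBAtRecordR13SepCoPH` (helper).  Last of the «RE-MASSED AC TOWER» files (I-a, I-b, II, III-a).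

WHAT THIS FILE PROVES (kernel; theorems only, 0 def; nothing of the paper asserted).
* §1 ★★ `printedUV3G_at_record_of_alphaAC_of_reMassed_of_window` — the printed pair `PrintedUV3G N L` at the record's binders along a FAMILY of re-massed AC inputs
  `S ↦ ({ (X S).toTowerBase 𝔠.lane.carrier with W := W′ S }).withSeriesAC (𝔖 S) _` from `RunAlphaAC` on the family, the five `W′`-hypotheses at every member, `εbg > 0`, the
  record's minimisers above level 0 and the level-0 window — file 14 §3's `printedUV3G_of_analyticLeaves_towerAC3_of_window` on III-a's bundles, at `C′ = {𝔠.lane.consts with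
  d := d + c_m}` (normalised; Thm 1's O(1) moves, the slot does not).
* §2 ★★★ `printedUV3V_at_slotOfRecord_of_alphaAC_of_massBoundAE_of_consts` — **THE SLOT OF RECORD `Node00.PrintedUV3V N L` for AC inputs AT PRINT'S OWN AVERAGING pinned to the
  record, from `RunAlphaAC` on the family ∧ «`massRecAC … (X S).av k h ≤ e^{c_m|T₁^{(k)}|}` `dU_k`-ALMOST EVERYWHERE, `1 ≤ k ≤ K`» ∧ `b₀p₀^{p₀}e^{1−p₀} ≤ εbg`** — the re-massing
  CHOSEN INSIDE THE PROOF: `W′_k(h,·) = min (massRecAC … k h) (e^{c_k})`, `c_0 = 0`, `c_k = c_m|T₁^{(k)}|` (`=ᵐ massRecAC` by the bound; `≤` it; measurable; `≥ 1` at the trivial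
  history; capped — all five hypotheses of III-a by elementary facts); ★★★ `…_of_consts'` — the A6 ∃X form along file 9 §2's inhabitant, the bound stated X-free on
  `MassesAC.massRecAC M₁ Rcol ε_L ε_S (avOfPrint N S)` — FILE 15's `…_of_consts'` WITH ITS POINTWISE ANTECEDENT REPLACED BY THE a.e. ONE.
* §3 ★★★ `printedUV3V_at_slotOfRecord_of_alphaAC_of_guardRec_of_consts'` — composed with file 17b: **`Node00.PrintedUV3V N L` ⟸ `RunAlphaAC`(print-averaging AC inputs pinned to the
  record) on the family ∧ «at every member, a guard-recursive family `ν` with `ν_k ≤ (e^{c_m|T₁^{(k)}|} − 1)·dU_k`, `k ≤ K`» ∧ `b₀p₀^{p₀}e^{1−p₀} ≤ εbg`** — N08's residual list in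
  AC currency is now: the (α)-AC rows + ONE `dV`-a.e. DENSITY BOUND for the transported guarded parts of [Balaban1985Averaging] (15) (equivalently, by file 17 §4, for the iterated
  one-step EXCESS of the transported reference measure over Haar) — no E6′, no pointwise statement about a version, no capped carrier owed by the lane.

LOCATED READING (count-neutral; plan ∕ node00-def ∕ pub-balaban3d ∕ the n08-w3 analysis lineage decide): (R4⁶) the two-part located input of `N08-E6PRIME-LOAD-POINT.md` is now
ONE-PART: (b) is discharged here in the kernel; (a) = «`dν_k∕dV_k ≤ e^{c|T₁^{(k)}|} − 1` a.e. for a guard-recursive (or the least) weakly-closed family at print's averaging».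

HONEST FRAMING: count-neutral helper; the (α)-AC rows and the density bound are HYPOTHESES = N08's object gap in AC currency; `PrintedUV3V` NOT proved; N08 NOT discharged;
E6′ neither used nor decided; one finite 𝕋⁴ programme at fixed ε, Bałaban AS PRINTED — R4 closes the conditional finite-𝕋⁴ rung `BalabanLadder.UV` only; the Yang–Mills mass
gap (Clay) is NOT proved by any of this; nothing continuum ∕ ℝ⁴ ∕ OS.  No `sorry`, standard axioms.
-/

noncomputable section

open MeasureTheory

namespace Summit.QuantumFields.YangMills.BalabanUVNodes.N08SlotOfRecordFromAlphaACMassBoundAE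

open Literature.MathematicalPhysics.QuantumFieldTheory.Balaban1983to89
open Literature.MathematicalPhysics.QuantumFieldTheory.Balaban1983to89.Node00 (SU TFamily₃)
open Literature.MathematicalPhysics.QuantumFieldTheory.Balaban1983to89.B10RunsOfRecord
open Literature.MathematicalPhysics.QuantumFieldTheory.Balaban1983to89.BlockAveraging (Small)
open Literature.MathematicalPhysics.QuantumFieldTheory.Balaban1983to89.ExpMeanLog (expMeanLogSU)
open Literature.MathematicalPhysics.QuantumFieldTheory.Balaban1985CMP102
open Literature.MathematicalPhysics.QuantumFieldTheory.Balaban1985CMP102.Setting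
open Literature.MathematicalPhysics.QuantumFieldTheory.Balaban1985CMP102.Theorems (Family)
open Summit.QuantumFields.Balaban3D
open Summit.QuantumFields.Balaban3D.Carriers (nblkOf StepSeries Hist rcolOf eps1Of epsSOf)
open Summit.QuantumFields.Balaban3D.Proofs
open Summit.QuantumFields.Balaban3D.Proofs.ScalesArithmetic (sites_nonneg)
open Summit.QuantumFields.Balaban3D.Proofs.Constants (eps0Of)
open Summit.QuantumFields.Balaban3D.Proofs.FamilyLE (le_of_eps0Of)
open Summit.QuantumFields.Balaban3D.Proofs.GroupModelLieC (lieC)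
open Summit.QuantumFields.Balaban3D.Proofs.TowerAC (HistWeightsAC TowerInputAC)
open Summit.QuantumFields.Balaban3D.Proofs.SeriesAC (TowerBaseAC)
open Summit.QuantumFields.Balaban3D.Proofs.StandardAC (ExternalInputsAC)
open Summit.QuantumFields.Balaban3D.Proofs.MassesAC (massRecAC massRecAC_nonneg massRecAC_zero one_le_massRecAC_triv measurable_massRecAC)
open Summit.QuantumFields.Balaban3D.Proofs.AlphaAC (AlphaDataAC RunAlphaAC)
open Summit.QuantumFields.YangMills.BalabanUVNodes.N08Thm2AsPrintedAtSlotOfRecordAC (exists_TFamily₃_of_av_eq exists_externalInputsAC_ofPrint)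
open Summit.QuantumFields.YangMills.BalabanUVNodes.N08Thm2AtRecordFromAlpha (window_of_famConsts pos_of_famConsts consts_adm_of_pos)
open Summit.QuantumFields.YangMills.BalabanUVNodes.N08SlotOfRecordFromAlphaAC (printedUV3G_of_analyticLeaves_towerAC3_of_window)
open Summit.QuantumFields.YangMills.BalabanUVNodes.N08ReMassedACLeaves (nonempty_analyticLeaves_reMassed usesConsts_reMassed)
open Summit.QuantumFields.YangMills.BalabanUVNodes.N08MassesACLeastClosedFamilyPrint (massRecAC_avOfPrint_le_exp_ae_of_guardRec)
open Summit.QuantumFields.YangMills.BalabanUVNodes.N08MassesACLeastClosedFamily (massRecAC_le_exp_ae_of_weakClosed)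
open Summit.QuantumFields.YangMills.BalabanUVNodes.N08Thm2AtRecordBridgeInhabited (avgAC_avOfPrint)

variable {N : ℕ} [NeZero N] {L : ℕ} {𝔊 : GroupModel (SU N)} {𝔠 : Primitives.AlphaConsts L 𝔊.N} {εbg cm : ℝ}
  {X : ∀ S : Scales L, ExternalInputsAC S (SU N)}
  {𝔖 : ∀ (S : Scales L) (k : ℕ), StepSeries S (SU N) ↥(lieC 𝔊) (nblkOf S 𝔠.lane.carrier k) k}
  {𝔄 : ∀ S : Scales L, AlphaDataAC 𝔊 𝔠 (X S) (𝔖 S)}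

/-! ## §1 The printed pair at the record's binders along a family of re-massed AC inputs -/

/-- ★★ **`PrintedUV3G` AT THE RECORD'S BINDERS ALONG RE-MASSED AC INPUTS, GIVEN THE WINDOW** (file 14 §3 on III-a's bundles at `C′ = {𝔠.lane.consts with d := d + c_m}`): AC external
inputs with the record's minimisers above level 0, `εbg > 0`, the window at every member of `Family L c⋆.eps0`, `RunAlphaAC` and the five `W′`-hypotheses at every member.
[cite: Balaban1985UV3, Thm 1 p.257 + Thm 2 p.272 + pp.256–274] -/
theorem printedUV3G_at_record_of_alphaAC_of_reMassed_of_window (W' : ∀ S : Scales L, HistWeightsAC S.P (SU N))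
    (hUk : ∀ (S : Scales L) k (V : GaugeField S.P (k + 1) (SU N)), (X S).Uk k V = UkA N (fun S => (X S).av) S (k + 1) εbg V) (hpos : 0 < εbg)
    (hwin : ∀ S : Family L (eps0Of 𝔠.gamma0), eps1OfPrint
        { eps0 := eps0Of 𝔠.gamma0,
          E := fun S => B10.Ek ((({ (X S).toTowerBase 𝔠.lane.carrier with W := W' S } : TowerBaseAC S (SU N)).withSeriesAC (𝔖 S)
            (Carriers.piecesParamsOf S 𝔠.lane.carrier)).Estep) S.K 0,
          b₀ := 𝔠.lane.F.b₀, p₀ := 𝔠.lane.F.p₀, εbg := εbg } S.1 0 ≤ εbg ∨ 2 < εbg)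
    (R : ∀ S : Family L (eps0Of 𝔠.gamma0), RunAlphaAC 𝔊 𝔠 (X S.1) (𝔖 S.1) (𝔄 S.1)) (hcm : 0 ≤ cm)
    (hae : ∀ S : Family L (eps0Of 𝔠.gamma0), ∀ j, j ≤ S.1.K → ∀ h : Hist S.1.P j, (W' S.1).mass j h =ᵐ[fieldMeasure S.1.P j (SU N)]
      massRecAC 𝔠.lane.carrier.M₁ (rcolOf S.1 𝔠.lane.carrier) (eps1Of S.1 𝔠.lane.carrier) (epsSOf S.1 𝔠.lane.carrier) (X S.1).av j h)
    (hdom : ∀ S : Family L (eps0Of 𝔠.gamma0), ∀ (j : ℕ) (h : Hist S.1.P j) (U : GaugeField S.1.P j (SU N)), (W' S.1).mass j h U ≤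
      massRecAC 𝔠.lane.carrier.M₁ (rcolOf S.1 𝔠.lane.carrier) (eps1Of S.1 𝔠.lane.carrier) (epsSOf S.1 𝔠.lane.carrier) (X S.1).av j h U)
    (hWm : ∀ S : Family L (eps0Of 𝔠.gamma0), ∀ (j : ℕ) (h : Hist S.1.P j), Measurable ((W' S.1).mass j h))
    (hmt : ∀ S : Family L (eps0Of 𝔠.gamma0), ∀ (j : ℕ) (U : GaugeField S.1.P j (SU N)), 1 ≤ (W' S.1).mass j (Hist.triv S.1.P j) U)
    (hcap : ∀ S : Family L (eps0Of 𝔠.gamma0), ∀ k, 1 ≤ k → k ≤ S.1.K → ∀ (h : Hist S.1.P k) (U : GaugeField S.1.P k (SU N)),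
      (W' S.1).mass k h U ≤ Real.exp (cm * S.1.sites k)) :
    PrintedUV3G N L (runObjects₀A N (fun S => (X S).av)
      (fun S j => (Carriers.run3 ((({ (X S).toTowerBase 𝔠.lane.carrier with W := W' S } : TowerBaseAC S (SU N)).withSeriesAC (𝔖 S)
        (Carriers.piecesParamsOf S 𝔠.lane.carrier)).toRunInput fun _ => True)).T j)
      (Backgrounds.ofAvg N L fun S => (X S).av)) := by
  refine printedUV3G_of_analyticLeaves_towerAC3_of_window
    (fun S => (({ (X S).toTowerBase 𝔠.lane.carrier with W := W' S } : TowerBaseAC S (SU N)).withSeriesAC (𝔖 S) (Carriers.piecesParamsOf S 𝔠.lane.carrier)))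
    { eps0 := eps0Of 𝔠.gamma0,
      E := fun S => B10.Ek ((({ (X S).toTowerBase 𝔠.lane.carrier with W := W' S } : TowerBaseAC S (SU N)).withSeriesAC (𝔖 S)
        (Carriers.piecesParamsOf S 𝔠.lane.carrier)).Estep) S.K 0,
      b₀ := 𝔠.lane.F.b₀, p₀ := 𝔠.lane.F.p₀, εbg := εbg }
    (consts_adm_of_pos 𝔠 hpos _) (fun _ _ => rfl) (fun S k V => hUk S k V) (fun _ => rfl) hwin
    (C := { 𝔠.lane.consts with d := 𝔠.lane.consts.d + cm, d_nonneg := add_nonneg 𝔠.lane.consts.d_nonneg hcm }) 𝔠.lane.normalised (fun S => ?_)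
    (fun S => nonempty_analyticLeaves_reMassed (le_of_eps0Of S.1 S.2) (W' S.1) _ rfl (hae S) (hdom S) (hWm S) (hmt S) hcm (hcap S) (R S))
  have u := usesConsts_reMassed (𝔠 := 𝔠) (X := X S.1) (𝔖 := 𝔖 S.1) (W' S.1) _ rfl (fun _ => True)
  exact ⟨u.M₁_eq, u.b₀_eq, u.p₀_eq, u.κ₀_eq, u.rcoef_eq, u.Λvol_nonneg⟩

/-! ## §2 The slot of record from the a.e. mass bound: the re-massing chosen inside the proof -/

/-- ★★★ **THE SLOT OF RECORD `Node00.PrintedUV3V N L` FROM THE (α)-AC ROWS AND A `dU`-a.e. EXTENSIVE MASS BOUND, `b₀p₀^{p₀}e^{1−p₀} ≤ εbg`** — AC inputs AT PRINT'S OWN AVERAGING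
(`(X S).av = avOfPrint N S`) pinned to the record; the bound «`massRecAC … (X S).av k h U ≤ exp(c_m|T₁^{(k)}|)` for `dU_k`-a.e. `U`, `1 ≤ k ≤ K`» on the family (what files 16∕17∕17b
reduce to a density bound on a closed family); the RE-MASSING `W′ = min (massRecAC) (e^{c_k})` is chosen HERE and satisfies III-a's five hypotheses by elementary facts.  NO E6′, no
pointwise statement about a Radon–Nikodym version. [cite: Balaban1985UV3, Thm 1 p.257 + Thm 2 p.272 + (41) p.266 + (7) p.257; Balaban1985Averaging, (15) p.19] -/
theorem printedUV3V_at_slotOfRecord_of_alphaAC_of_massBoundAE_of_consts (hav : ∀ S, (X S).av = avOfPrint N S)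
    (hUk : ∀ (S : Scales L) k (V : GaugeField S.P (k + 1) (SU N)), (X S).Uk k V = UkA N (fun S => (X S).av) S (k + 1) εbg V)
    (hε : 𝔠.lane.F.b₀ * (𝔠.lane.F.p₀ ^ 𝔠.lane.F.p₀ * Real.exp (1 - 𝔠.lane.F.p₀)) ≤ εbg)
    (R : ∀ S : Family L (eps0Of 𝔠.gamma0), RunAlphaAC 𝔊 𝔠 (X S.1) (𝔖 S.1) (𝔄 S.1)) (hcm : 0 ≤ cm)
    (hmass : ∀ S : Family L (eps0Of 𝔠.gamma0), ∀ k, 1 ≤ k → k ≤ S.1.K → ∀ h : Hist S.1.P k, ∀ᵐ U ∂(fieldMeasure S.1.P k (SU N)),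
      massRecAC 𝔠.lane.carrier.M₁ (rcolOf S.1 𝔠.lane.carrier) (eps1Of S.1 𝔠.lane.carrier) (epsSOf S.1 𝔠.lane.carrier) (X S.1).av k h U ≤ Real.exp (cm * S.1.sites k)) :
    Node00.PrintedUV3V N L := by
  classical
  -- the scale profile and the re-massing: `min (massRecAC) (e^{c_k})`, `c_0 = 0`, `c_k = c_m|T₁^{(k)}|`
  let c : ∀ S : Scales L, ℕ → ℝ := fun S k => if k = 0 then 0 else cm * S.sites k
  have hc0 : ∀ S k, 0 ≤ c S k := fun S k => by
    by_cases hk : k = 0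
    · simp only [c, if_pos hk]; exact le_rfl
    · simp only [c, if_neg hk]; exact mul_nonneg hcm (sites_nonneg S k)
  let W' : ∀ S : Scales L, HistWeightsAC S.P (SU N) := fun S =>
    { mass := fun k h U => min (massRecAC 𝔠.lane.carrier.M₁ (rcolOf S 𝔠.lane.carrier) (eps1Of S 𝔠.lane.carrier) (epsSOf S 𝔠.lane.carrier) (X S).av k h U)
        (Real.exp (c S k))
      mass_nonneg := fun k h U => le_min (massRecAC_nonneg _ _ _ _ _ k h U) (Real.exp_pos _).le
      mass_zero := fun h U => by
        show min (massRecAC 𝔠.lane.carrier.M₁ (rcolOf S 𝔠.lane.carrier) (eps1Of S 𝔠.lane.carrier) (epsSOf S 𝔠.lane.carrier) (X S).av 0 h U)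
          (Real.exp (c S 0)) = 1
        rw [massRecAC_zero]
        simp only [c, if_true, Real.exp_zero, min_self] }
  -- the five hypotheses of III-a
  have hae : ∀ S : Family L (eps0Of 𝔠.gamma0), ∀ j, j ≤ S.1.K → ∀ h : Hist S.1.P j, (W' S.1).mass j h =ᵐ[fieldMeasure S.1.P j (SU N)]
      massRecAC 𝔠.lane.carrier.M₁ (rcolOf S.1 𝔠.lane.carrier) (eps1Of S.1 𝔠.lane.carrier) (epsSOf S.1 𝔠.lane.carrier) (X S.1).av j h := by
    intro S j hj h
    by_cases hj0 : j = 0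
    · subst hj0
      refine Filter.Eventually.of_forall fun U => ?_
      show min _ _ = _
      rw [massRecAC_zero]
      simp only [c, if_true, Real.exp_zero, min_self]
    · have h1 : 1 ≤ j := Nat.one_le_iff_ne_zero.mpr hj0
      filter_upwards [hmass S j h1 hj h] with U hU
      show min _ _ = _
      simp only [c, if_neg hj0]
      exact min_eq_left hU
  have hdom : ∀ S : Family L (eps0Of 𝔠.gamma0), ∀ (j : ℕ) (h : Hist S.1.P j) (U : GaugeField S.1.P j (SU N)), (W' S.1).mass j h U ≤
      massRecAC 𝔠.lane.carrier.M₁ (rcolOf S.1 𝔠.lane.carrier) (eps1Of S.1 𝔠.lane.carrier) (epsSOf S.1 𝔠.lane.carrier) (X S.1).av j h U :=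
    fun S j h U => min_le_left _ _
  have hWm : ∀ S : Family L (eps0Of 𝔠.gamma0), ∀ (j : ℕ) (h : Hist S.1.P j), Measurable ((W' S.1).mass j h) :=
    fun S j h => (measurable_massRecAC _ _ _ _ _ j h).min measurable_const
  have hmt : ∀ S : Family L (eps0Of 𝔠.gamma0), ∀ (j : ℕ) (U : GaugeField S.1.P j (SU N)), 1 ≤ (W' S.1).mass j (Hist.triv S.1.P j) U :=
    fun S j U => le_min (one_le_massRecAC_triv _ _ _ _ _ j U) (Real.one_le_exp (hc0 S.1 j))
  have hcap : ∀ S : Family L (eps0Of 𝔠.gamma0), ∀ k, 1 ≤ k → k ≤ S.1.K → ∀ (h : Hist S.1.P k) (U : GaugeField S.1.P k (SU N)),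
      (W' S.1).mass k h U ≤ Real.exp (cm * S.1.sites k) := by
    intro S k hk1 _ h U
    have hk0 : k ≠ 0 := by omega
    calc (W' S.1).mass k h U ≤ Real.exp (c S.1 k) := min_le_right _ _
      _ = Real.exp (cm * S.1.sites k) := by simp only [c, if_neg hk0]
  -- the printed pair along the re-massed inputs, then the transfer to the slot of record's own binders
  obtain ⟨𝔗', h'⟩ := exists_TFamily₃_of_av_eq (N := N) (𝔞 := fun S => (X S).av) (funext hav)
    (fun S j => (Carriers.run3 ((({ (X S).toTowerBase 𝔠.lane.carrier with W := W' S } : TowerBaseAC S (SU N)).withSeriesAC (𝔖 S)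
      (Carriers.piecesParamsOf S 𝔠.lane.carrier)).toRunInput fun _ => True)).T j)
  have hR : runObjects₀A N (fun S => (X S).av)
      (fun S j => (Carriers.run3 ((({ (X S).toTowerBase 𝔠.lane.carrier with W := W' S } : TowerBaseAC S (SU N)).withSeriesAC (𝔖 S)
        (Carriers.piecesParamsOf S 𝔠.lane.carrier)).toRunInput fun _ => True)).T j)
      (Backgrounds.ofAvg N L fun S => (X S).av) = runObjects₀T N 𝔗' (Backgrounds.ofPrint N L) :=
    funext fun c' => funext fun S => h' c' S
  exact ⟨𝔗', hR ▸ printedUV3G_at_record_of_alphaAC_of_reMassed_of_window (𝔄 := 𝔄) W' hUk (pos_of_famConsts hε)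
    (fun S => window_of_famConsts hε _ S.1) R hcm hae hdom hWm hmt hcap⟩

variable (N L) in
/-- ★★★ **THE SLOT OF RECORD FROM ITS AC RESIDUALS WITH THE MASS BOUND STATED `dU`-a.e. ON PRINT'S OWN MASSES — A6 FORM** (file 9 §2's inhabitant: AC external inputs AT PRINT'S
AVERAGING with the record's classes and minimisers EXIST): for every `SU(N)`, `𝔠`, `εbg` with `b₀p₀^{p₀}e^{1−p₀} ≤ εbg`, `c_m ≥ 0`, THERE ARE such inputs `X`, and for every expansion
data `𝔖` and (α)-AC data `𝔄` over them, **the (α)-AC rows on the family ∧ «`massRecAC … (avOfPrint N S) k h ≤ exp(c_m|T₁^{(k)}|)` `dU_k`-a.e., `1 ≤ k ≤ K`» ⇒ `Node00.PrintedUV3V N L`**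
— file 15's `…_of_consts'` with its pointwise antecedent replaced by the a.e. one: the letter analysis can discharge. [cite: Balaban1985UV3, Thm 1 p.257 + Thm 2 p.272 + (41) p.266; Balaban1985Averaging, (15) p.19] -/
theorem printedUV3V_at_slotOfRecord_of_alphaAC_of_massBoundAE_of_consts' (𝔊 : GroupModel (SU N)) (𝔠 : Primitives.AlphaConsts L 𝔊.N) (εbg cm : ℝ)
    (hε : 𝔠.lane.F.b₀ * (𝔠.lane.F.p₀ ^ 𝔠.lane.F.p₀ * Real.exp (1 - 𝔠.lane.F.p₀)) ≤ εbg) (hcm : 0 ≤ cm) :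
    ∃ X : ∀ S : Scales L, ExternalInputsAC S (SU N), (∀ S, (X S).av = avOfPrint N S) ∧
      ∀ (𝔖 : ∀ (S : Scales L) (k : ℕ), StepSeries S (SU N) ↥(lieC 𝔊) (nblkOf S 𝔠.lane.carrier k) k)
        (𝔄 : ∀ S : Scales L, AlphaDataAC 𝔊 𝔠 (X S) (𝔖 S)),
        (∀ S : Family L (eps0Of 𝔠.gamma0), RunAlphaAC 𝔊 𝔠 (X S.1) (𝔖 S.1) (𝔄 S.1)) →
        (∀ S : Family L (eps0Of 𝔠.gamma0), ∀ k, 1 ≤ k → k ≤ S.1.K → ∀ h : Hist S.1.P k, ∀ᵐ U ∂(fieldMeasure S.1.P k (SU N)),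
          massRecAC 𝔠.lane.carrier.M₁ (rcolOf S.1 𝔠.lane.carrier) (eps1Of S.1 𝔠.lane.carrier) (epsSOf S.1 𝔠.lane.carrier) (avOfPrint N S.1) k h U ≤
            Real.exp (cm * S.1.sites k)) →
        Node00.PrintedUV3V N L := by
  obtain ⟨X, hav, -, hUk⟩ := exists_externalInputsAC_ofPrint N L εbg
  refine ⟨X, hav, fun 𝔖 𝔄 R hmass => printedUV3V_at_slotOfRecord_of_alphaAC_of_massBoundAE_of_consts (𝔄 := 𝔄) hav hUk hε R hcm fun S k hk1 hkK h => ?_⟩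
  have hX : (X S.1).av = avOfPrint N S.1 := hav S.1
  rw [hX]
  exact hmass S k hk1 hkK h

/-! ## §3 Composition with file 17b: the slot of record from the (α)-AC rows and a density bound on a guard-recursive family -/

variable (N L) in
/-- ★★★ **THE SLOT OF RECORD FROM THE (α)-AC ROWS AND A DENSITY BOUND ON A GUARD-RECURSIVE FAMILY AT PRINT'S AVERAGING — A6 FORM**: for every `SU(N)`, `𝔠`, `εbg` with
`b₀p₀^{p₀}e^{1−p₀} ≤ εbg`, `c_m ≥ 0`, there are AC external inputs `X` at print's averaging pinned to the record such that, for every `𝔖`, `𝔄`: the (α)-AC rows on the family ∧ «at every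
member, SOME family `ν` with `ν_{j+1} ≥ (dU_j↾G_j)∘Ū_j⁻¹ + ν_j∘Ū_j⁻¹` (`j + 1 ≤ K`) and `ν_k ≤ (e^{c_m|T₁^{(k)}|} − 1)·dU_k` (`k ≤ K`)» ⇒ `Node00.PrintedUV3V N L` (file 17b's
`massRecAC_avOfPrint_le_exp_ae_of_guardRec` feeds §2).  N08's residual list in AC currency: the (α)-AC rows + that density bound. [cite: Balaban1985UV3, Thm 1 p.257 + Thm 2 p.272 + (41) p.266; Balaban1985Averaging, (15) p.19; Balaban1987RG1, (0.4) p.253] -/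
theorem printedUV3V_at_slotOfRecord_of_alphaAC_of_guardRec_of_consts' (𝔊 : GroupModel (SU N)) (𝔠 : Primitives.AlphaConsts L 𝔊.N) (εbg cm : ℝ)
    (hε : 𝔠.lane.F.b₀ * (𝔠.lane.F.p₀ ^ 𝔠.lane.F.p₀ * Real.exp (1 - 𝔠.lane.F.p₀)) ≤ εbg) (hcm : 0 ≤ cm) :
    ∃ X : ∀ S : Scales L, ExternalInputsAC S (SU N), (∀ S, (X S).av = avOfPrint N S) ∧
      ∀ (𝔖 : ∀ (S : Scales L) (k : ℕ), StepSeries S (SU N) ↥(lieC 𝔊) (nblkOf S 𝔠.lane.carrier k) k)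
        (𝔄 : ∀ S : Scales L, AlphaDataAC 𝔊 𝔠 (X S) (𝔖 S)),
        (∀ S : Family L (eps0Of 𝔠.gamma0), RunAlphaAC 𝔊 𝔠 (X S.1) (𝔖 S.1) (𝔄 S.1)) →
        (∀ S : Family L (eps0Of 𝔠.gamma0), ∃ ν : ∀ k, Measure (GaugeField S.1.P k (SU N)),
          (∀ j, j + 1 ≤ S.1.K →
            ((fieldMeasure S.1.P j (SU N)).restrict
                {U : GaugeField S.1.P j (SU N) | ∃ c : PBond S.1.P (j + 1), Small (expMeanLogSU : LoopAverage (SU N)) U c}).map (avOfPrint N S.1 j).avg +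
              (ν j).map (avOfPrint N S.1 j).avg ≤ ν (j + 1)) ∧
          (∀ k, k ≤ S.1.K → ν k ≤ ENNReal.ofReal (Real.exp (cm * S.1.sites k) - 1) • fieldMeasure S.1.P k (SU N))) →
        Node00.PrintedUV3V N L := by
  obtain ⟨X, hav, h⟩ := printedUV3V_at_slotOfRecord_of_alphaAC_of_massBoundAE_of_consts' N L 𝔊 𝔠 εbg cm hε hcm
  refine ⟨X, hav, fun 𝔖 𝔄 R hν => h 𝔖 𝔄 R fun S k hk1 hkK hh => ?_⟩
  obtain ⟨ν, hrec, hνc⟩ := hν S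
  exact massRecAC_avOfPrint_le_exp_ae_of_guardRec N S.1 𝔠.lane.carrier.M₁ (rcolOf S.1 𝔠.lane.carrier) (eps1Of S.1 𝔠.lane.carrier) (epsSOf S.1 𝔠.lane.carrier)
    ν hrec (fun k => cm * S.1.sites k) (fun k => mul_nonneg hcm (sites_nonneg S.1 k)) hνc k hkK hh

variable (N L) in
/-- ★★★ **THE SLOT OF RECORD FROM THE (α)-AC ROWS AND A DENSITY BOUND ON ANY WEAKLY-CLOSED FAMILY AT PRINT'S AVERAGING — A6 FORM** (the most general closed-family letter, file 17
§3: `(dU_k + ν_k)∘Ū_k⁻¹ ≤ dU_{k+1} + ν_{k+1}` for `k < K` and `ν_k ≤ (e^{c_m|T₁^{(k)}|} − 1)·dU_k` for `k ≤ K`; the least such family is file 17's `ν♯`, the iterated one-step excess over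
Haar). [cite: Balaban1985UV3, Thm 1 p.257 + Thm 2 p.272 + (41) p.266; Balaban1985Averaging, (15) p.19] -/
theorem printedUV3V_at_slotOfRecord_of_alphaAC_of_weakClosed_of_consts' (𝔊 : GroupModel (SU N)) (𝔠 : Primitives.AlphaConsts L 𝔊.N) (εbg cm : ℝ)
    (hε : 𝔠.lane.F.b₀ * (𝔠.lane.F.p₀ ^ 𝔠.lane.F.p₀ * Real.exp (1 - 𝔠.lane.F.p₀)) ≤ εbg) (hcm : 0 ≤ cm) :
    ∃ X : ∀ S : Scales L, ExternalInputsAC S (SU N), (∀ S, (X S).av = avOfPrint N S) ∧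
      ∀ (𝔖 : ∀ (S : Scales L) (k : ℕ), StepSeries S (SU N) ↥(lieC 𝔊) (nblkOf S 𝔠.lane.carrier k) k)
        (𝔄 : ∀ S : Scales L, AlphaDataAC 𝔊 𝔠 (X S) (𝔖 S)),
        (∀ S : Family L (eps0Of 𝔠.gamma0), RunAlphaAC 𝔊 𝔠 (X S.1) (𝔖 S.1) (𝔄 S.1)) →
        (∀ S : Family L (eps0Of 𝔠.gamma0), ∃ ν : ∀ k, Measure (GaugeField S.1.P k (SU N)),
          (∀ k, k < S.1.K → (fieldMeasure S.1.P k (SU N) + ν k).map (avOfPrint N S.1 k).avg ≤ fieldMeasure S.1.P (k + 1) (SU N) + ν (k + 1)) ∧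
          (∀ k, k ≤ S.1.K → ν k ≤ ENNReal.ofReal (Real.exp (cm * S.1.sites k) - 1) • fieldMeasure S.1.P k (SU N))) →
        Node00.PrintedUV3V N L := by
  obtain ⟨X, hav, h⟩ := printedUV3V_at_slotOfRecord_of_alphaAC_of_massBoundAE_of_consts' N L 𝔊 𝔠 εbg cm hε hcm
  refine ⟨X, hav, fun 𝔖 𝔄 R hν => h 𝔖 𝔄 R fun S k hk1 hkK hh => ?_⟩
  obtain ⟨ν, hstep, hνc⟩ := hν S
  exact massRecAC_le_exp_ae_of_weakClosed 𝔠.lane.carrier.M₁ (rcolOf S.1 𝔠.lane.carrier) (eps1Of S.1 𝔠.lane.carrier) (epsSOf S.1 𝔠.lane.carrier) (avOfPrint N S.1)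
    (avgAC_avOfPrint N L S.1) S.1.K ν hstep (fun k => cm * S.1.sites k) (fun k => mul_nonneg hcm (sites_nonneg S.1 k)) hνc k hkK hh

variable (N L) in
/-- ★★ **COROLLARY — E6′ READ AS A MEASURE INEQUALITY SUFFICES (the case `c_m = 0`, `ν := 0`)**: for every `SU(N)`, `𝔠`, `εbg` with `b₀p₀^{p₀}e^{1−p₀} ≤ εbg` there are AC external
inputs `X` at print's averaging pinned to the record such that the (α)-AC rows on the family ∧ «`(dU_j)∘Ū_j⁻¹ ≤ dU_{j+1}` for `j < K` at every member» (sub-Haar = exact Haar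
compatibility of [Balaban1985Averaging] (15), levelwise, as measures) ⇒ `Node00.PrintedUV3V N L` — consistent with file 13 §4 (E6′ via the std lane), now through the AC lane
with no pointwise `av_map` field. [cite: Balaban1985UV3, Thm 1 p.257 + Thm 2 p.272; Balaban1985Averaging, (13)+(15) p.19] -/
theorem printedUV3V_at_slotOfRecord_of_alphaAC_of_haarCompat_of_consts' (𝔊 : GroupModel (SU N)) (𝔠 : Primitives.AlphaConsts L 𝔊.N) (εbg : ℝ)
    (hε : 𝔠.lane.F.b₀ * (𝔠.lane.F.p₀ ^ 𝔠.lane.F.p₀ * Real.exp (1 - 𝔠.lane.F.p₀)) ≤ εbg) :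
    ∃ X : ∀ S : Scales L, ExternalInputsAC S (SU N), (∀ S, (X S).av = avOfPrint N S) ∧
      ∀ (𝔖 : ∀ (S : Scales L) (k : ℕ), StepSeries S (SU N) ↥(lieC 𝔊) (nblkOf S 𝔠.lane.carrier k) k)
        (𝔄 : ∀ S : Scales L, AlphaDataAC 𝔊 𝔠 (X S) (𝔖 S)),
        (∀ S : Family L (eps0Of 𝔠.gamma0), RunAlphaAC 𝔊 𝔠 (X S.1) (𝔖 S.1) (𝔄 S.1)) →
        (∀ S : Family L (eps0Of 𝔠.gamma0), ∀ j, j < S.1.K →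
          (fieldMeasure S.1.P j (SU N)).map (avOfPrint N S.1 j).avg ≤ fieldMeasure S.1.P (j + 1) (SU N)) →
        Node00.PrintedUV3V N L := by
  obtain ⟨X, hav, h⟩ := printedUV3V_at_slotOfRecord_of_alphaAC_of_weakClosed_of_consts' N L 𝔊 𝔠 εbg 0 hε le_rfl
  refine ⟨X, hav, fun 𝔖 𝔄 R hH => h 𝔖 𝔄 R fun S => ⟨fun _ => 0, fun k hk => ?_, fun k _ => Measure.zero_le _⟩⟩
  rw [add_zero, add_zero]
  exact hH S k hk

end Summit.QuantumFields.YangMills.BalabanUVNodes.N08SlotOfRecordFromAlphaACMassBoundAE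

end
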